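import Literature.AlgebraicGeometry.AbelianSchemes.AbelianSchemeEndomorphismComplexDescent
import Literature.AlgebraicGeometry.Motives.AlgPointsSeparate
import HarnessLib

/-!
# B-γ's fibre hypothesis from complex points: `r ∘ galA σ` and `galA σ ∘ r` agree on the fibre over a complex point as soon as their
# first projections agree at every complex point of that fibre ([MumfordAV1970] §4 «points separate morphisms»; [MFK94] Ch. 6 §1 Cor. 6.2)

Topic `AlgebraicGeometry/AbelianSchemes`; namespace `Literature.AlgebraicGeometry.AbelianSchemes.AbelianSchemeOver`.
THEOREMS ONLY (no definition, no named fact, no instance, no `sorry`; net Literature debt 0).  Cell `hodgecm-mathlib` (D-0151), FLOOR 0, P6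
door (E) of `stub_RGD`, E6 step 8 — **E6-γ brick (G2a)**, the plumbing half of the CM-point fibre condition: ★ B-γ
`forall_gal_comp_eq_of_forall_exists_fieldPoint` (AbelianSchemeEndomorphismComplexDescent §2) asks, at a field-valued point `s` of `T_ℂ`, for
`s̃ ≫ r ≫ galA σ = s̃ ≫ galA σ ≫ r` on the fibre `A_ℂ ×_{T_ℂ} s`; the analytic organ (A-p06 `ReadsC` (ii)) and the CM computation (★ E6-γ A∕B∕C
p847080 ∕ p847121) deliver identities between COMPLEX POINTS of the total space read through their first projection to `A`.  This file closes the
gap: at an honest complex point `x̃` (`x̃ ≫ pr_ℂ = 𝟙`), the fibre identity follows from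
**`(q ≫ r) ≫ pr_A = (q ≫ galA σ ≫ r) ≫ pr_A` for every complex point `q` of `A_ℂ` over `x̃`**.
`--supports stmt-HodgeConjecture-24832`, count-neutral; HC_CM is proved only modulo the printed citations until rung 0 closes.

Binders = ★ B-γ's VERBATIM (`K`, `T : SchemeOver K`, `A : AbelianSchemeOver T.left`, by-value `galA` with the two clauses `hgal₁`, `hgal₂`,
`r` an endomorphism of `A_ℂ := A.baseChange (pullback.fst T.hom (bcSpec K ℂ))`), plus `[IsSeparated T.hom]` (as in B-γ §3).
Proof: the two composites `F → A_ℂ` both lie over `x̃ ≫ gal σ`, i.e. they are morphisms of `ℂ`-schemes for the structure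
`pr_{T_ℂ} ≫ pr_ℂ ≫ Spec σ` on `A_ℂ` (★ `GaloisDescent.gal_snd`: `gal σ ≫ pr_ℂ = pr_ℂ ≫ Spec σ⁻¹`); the fibre `F` is a complex abelian variety, hence
reduced and of finite type, and `A_ℂ` is separated over `ℂ`; so (★ `Motives.ext_of_forall_point_eq`, [MumfordAV1970] §4) they agree once they agree
at every complex point `P` of `F`, where — the second projections agreeing automatically — the hypothesis is exactly the first projection.

## References
* [MumfordAV1970] D. Mumford, *Abelian Varieties* (1970), §4 (points separate morphisms of varieties).
* [MumfordFogartyKirwan1994] D. Mumford, J. Fogarty, F. Kirwan, *Geometric Invariant Theory*, 3rd ed. (1994), Ch. 6 §1 Cor. 6.2 (p. 116).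
* [GortzWedhorn2020] U. Görtz, T. Wedhorn, *Algebraic Geometry I*, 2nd ed. (2020), §(14.20), Prop. 9.2.
-/

set_option autoImplicit false

noncomputable section

open CategoryTheory CategoryTheory.Limits AlgebraicGeometry
open Literature.AlgebraicGeometry.Motives (SchemeOver)
open Literature.AlgebraicGeometry.Motives.GaloisDescent (gal bc gal_fst gal_snd gal_fst_assoc gal_snd_assoc)
open Literature.AlgebraicGeometry.Motives.AbelianVariety (bcSpec specAut specAut_mul specAut_one)

namespace Literature.AlgebraicGeometry.AbelianSchemes

namespace AbelianSchemeOver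

variable {K : Type} [Field K] [Algebra K ℂ] {T : SchemeOver K} (A : AbelianSchemeOver T.left)
  (galA : (ℂ ≃ₐ[K] ℂ) →
    (pullback A.X.hom (pullback.fst T.hom (bcSpec K ℂ)) ⟶ pullback A.X.hom (pullback.fst T.hom (bcSpec K ℂ))))
  (hgal₁ : ∀ σ, galA σ ≫ pullback.fst A.X.hom (pullback.fst T.hom (bcSpec K ℂ)) =
    pullback.fst A.X.hom (pullback.fst T.hom (bcSpec K ℂ)))
  (hgal₂ : ∀ σ, galA σ ≫ pullback.snd A.X.hom (pullback.fst T.hom (bcSpec K ℂ)) =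
    pullback.snd A.X.hom (pullback.fst T.hom (bcSpec K ℂ)) ≫ gal ℂ T σ)
  (r : (A.baseChange (pullback.fst T.hom (bcSpec K ℂ))).X ⟶ (A.baseChange (pullback.fst T.hom (bcSpec K ℂ))).X)

include hgal₁ hgal₂ in
/-- **The fibre identity at an honest complex point, from complex points — for any endomorphism `rl` of the total space `A_ℂ` over `T_ℂ`**
([MumfordAV1970] §4; [MumfordFogartyKirwan1994] Ch. 6 §1 Cor. 6.2): let `x̃ : Spec ℂ → T_ℂ` be a complex point over `ℂ` (`x̃ ≫ pr_ℂ = 𝟙`).  If for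
every complex point `q` of `A_ℂ` lying over `x̃` the points `q ≫ rl` and `q ≫ galA σ ≫ rl` have the same first projection to `A`, then
`pr ≫ rl ≫ galA σ = pr ≫ galA σ ≫ rl` on the fibre `A_ℂ ×_{T_ℂ} x̃`.  Points separate morphisms out of the reduced finite-type fibre into the
separated `A_ℂ` (★ `Motives.ext_of_forall_point_eq`), for the `ℂ`-structure `pr_{T_ℂ} ≫ pr_ℂ ≫ Spec σ` on `A_ℂ` over which both composites lie
(★ `gal_snd`); the second projections agree automatically. [cite: MumfordAV1970, §4] [cite: MumfordFogartyKirwan1994, Ch. 6 §1 Corollary 6.2 (p. 116)] -/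
theorem fibre_comp_galA_eq_of_forall_point' [IsSeparated T.hom] (σ : ℂ ≃ₐ[K] ℂ)
    (rl : pullback A.X.hom (pullback.fst T.hom (bcSpec K ℂ)) ⟶ pullback A.X.hom (pullback.fst T.hom (bcSpec K ℂ)))
    (hrl : rl ≫ pullback.snd A.X.hom (pullback.fst T.hom (bcSpec K ℂ)) = pullback.snd A.X.hom (pullback.fst T.hom (bcSpec K ℂ)))
    (x : Spec (.of ℂ) ⟶ bc ℂ T) (hx : x ≫ pullback.snd T.hom (bcSpec K ℂ) = 𝟙 _)
    (h : ∀ q : Spec (.of ℂ) ⟶ pullback A.X.hom (pullback.fst T.hom (bcSpec K ℂ)),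
      q ≫ pullback.snd A.X.hom (pullback.fst T.hom (bcSpec K ℂ)) = x →
        (q ≫ rl) ≫ pullback.fst A.X.hom (pullback.fst T.hom (bcSpec K ℂ)) =
          (q ≫ galA σ ≫ rl) ≫ pullback.fst A.X.hom (pullback.fst T.hom (bcSpec K ℂ))) :
    pullback.fst (pullback.snd A.X.hom (pullback.fst T.hom (bcSpec K ℂ))) x ≫ rl ≫ galA σ =
      pullback.fst (pullback.snd A.X.hom (pullback.fst T.hom (bcSpec K ℂ))) x ≫ galA σ ≫ rl := by
  -- instances on the fibre and on the total space
  haveI := A.isSmooth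
  haveI := A.isProper
  haveI : LocallyOfFiniteType (pullback.snd A.X.hom (pullback.fst T.hom (bcSpec K ℂ))) := inferInstance
  haveI : IsSeparated (pullback.snd A.X.hom (pullback.fst T.hom (bcSpec K ℂ))) := inferInstance
  haveI : IsReduced (pullback (pullback.snd A.X.hom (pullback.fst T.hom (bcSpec K ℂ))) x) :=
    Literature.AlgebraicGeometry.Motives.AbelianVariety.isReduced_left
      (((A.baseChange (pullback.fst T.hom (bcSpec K ℂ))).fibre x).toAbelianVariety)
  -- both composites are morphisms over `Spec ℂ` for the twisted structure `pr ≫ pr_ℂ ≫ Spec σ` of `A_ℂ`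
  refine Literature.AlgebraicGeometry.Motives.ext_of_forall_point_eq (K := ℂ)
    (pullback.snd (pullback.snd A.X.hom (pullback.fst T.hom (bcSpec K ℂ))) x)
    (pullback.snd A.X.hom (pullback.fst T.hom (bcSpec K ℂ)) ≫ pullback.snd T.hom (bcSpec K ℂ) ≫ specAut ℂ σ) ℂ ?_ ?_ ?_
  · rw [Category.assoc, Category.assoc, reassoc_of% (hgal₂ σ), reassoc_of% hrl, gal_snd_assoc, ← specAut_mul,
      inv_mul_cancel, specAut_one, Category.comp_id, pullback.condition_assoc, hx, Category.comp_id]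
  · rw [Category.assoc, Category.assoc, reassoc_of% hrl, reassoc_of% (hgal₂ σ), gal_snd_assoc,
      ← specAut_mul, inv_mul_cancel, specAut_one, Category.comp_id, pullback.condition_assoc, hx, Category.comp_id]
  · intro P hP
    have hP1 : P ≫ pullback.snd (pullback.snd A.X.hom (pullback.fst T.hom (bcSpec K ℂ))) x = 𝟙 _ := by
      rw [hP, Algebra.algebraMap_self, CommRingCat.ofHom_id]
      exact Spec.map_id _
    have hq : (P ≫ pullback.fst (pullback.snd A.X.hom (pullback.fst T.hom (bcSpec K ℂ))) x) ≫
        pullback.snd A.X.hom (pullback.fst T.hom (bcSpec K ℂ)) = x := by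
      rw [Category.assoc, pullback.condition, reassoc_of% hP1]
    have key : (P ≫ pullback.fst (pullback.snd A.X.hom (pullback.fst T.hom (bcSpec K ℂ))) x) ≫ rl ≫ galA σ =
        (P ≫ pullback.fst (pullback.snd A.X.hom (pullback.fst T.hom (bcSpec K ℂ))) x) ≫ galA σ ≫ rl := by
      apply pullback.hom_ext
      · simpa only [Category.assoc, hgal₁] using h _ hq
      · simp only [Category.assoc, hgal₂, hrl, reassoc_of% hrl]
    simpa only [Category.assoc] using key

include hgal₁ hgal₂ in
/-- **B-γ's fibre identity at an honest complex point, from complex points** — the case `rl := r.left` of a HOMOMORPHISM `r : A_ℂ → A_ℂ` over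
`T_ℂ` (★ B-γ's letter): the hypothesis of ★ `gal_comp_eq_of_forall_exists_fieldPoint` at `s := x̃` (`L := ℂ`) follows from
`(q ≫ r) ≫ pr_A = (q ≫ galA σ ≫ r) ≫ pr_A` for every complex point `q` of `A_ℂ` over `x̃`. [cite: MumfordAV1970, §4]
[cite: MumfordFogartyKirwan1994, Ch. 6 §1 Corollary 6.2 (p. 116)] -/
theorem fibre_comp_galA_eq_of_forall_point [IsSeparated T.hom] (σ : ℂ ≃ₐ[K] ℂ)
    (x : Spec (.of ℂ) ⟶ bc ℂ T) (hx : x ≫ pullback.snd T.hom (bcSpec K ℂ) = 𝟙 _)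
    (h : ∀ q : Spec (.of ℂ) ⟶ pullback A.X.hom (pullback.fst T.hom (bcSpec K ℂ)),
      q ≫ pullback.snd A.X.hom (pullback.fst T.hom (bcSpec K ℂ)) = x →
        (q ≫ r.left) ≫ pullback.fst A.X.hom (pullback.fst T.hom (bcSpec K ℂ)) =
          (q ≫ galA σ ≫ r.left) ≫ pullback.fst A.X.hom (pullback.fst T.hom (bcSpec K ℂ))) :
    pullback.fst (pullback.snd A.X.hom (pullback.fst T.hom (bcSpec K ℂ))) x ≫ r.left ≫ galA σ =
      pullback.fst (pullback.snd A.X.hom (pullback.fst T.hom (bcSpec K ℂ))) x ≫ galA σ ≫ r.left :=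
  A.fibre_comp_galA_eq_of_forall_point' galA hgal₁ hgal₂ σ r.left (Over.w r) x hx h

end AbelianSchemeOver

end Literature.AlgebraicGeometry.AbelianSchemes

end
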